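import Mathlib.Algebra.Module.PID
import Mathlib.NumberTheory.Padics.RingHoms
import HarnessLib

/-!
# Finitely generated `ℤ_p`-modules as abelian groups

The structure theorem for finitely generated modules over the principal ideal domain `ℤ_p`
(Mathlib `Module.equiv_free_prod_directSum`, specialised): a finitely generated `ℤ_p`-module `M`
is isomorphic to `ℤ_p^b × T` with `T` a *finite* `ℤ_p`-module (a finite abelian `p`-group), because
every non-zero ideal of `ℤ_p` is `(p^n)` (Mathlib `PadicInt.ideal_eq_span_pow_p`) and
`ℤ_p/(p^n) ≅ ℤ/p^n` is finite (Mathlib `PadicInt.ker_toZModPow`).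

* `Literature.Algebra.Module.PadicInt.finite_quotient_span_singleton` : `ℤ_p/(x)` is finite for `x ≠ 0`;
* `Literature.Algebra.Module.PadicInt.exists_linearEquiv_prod_finite` : `M ≃ₗ[ℤ_p] (Fin b → ℤ_p) × T`,
  `T` finite;
* `Literature.Algebra.Module.PadicInt.exists_addEquiv_prod_finite` : the same for the underlying
  additive groups (the form consumed by group-level "`ℤ_ℓ^b × finite`" statements such as
  `Literature.AlgebraicGeometry.Motives.exists_addEquiv_geometricEllAdicCohomology`).

Everything here is proved from Mathlib; there are no named facts in this file.

## References

* N. Bourbaki, *Algèbre*, Ch. VII §4 no. 4 (structure of finitely generated modules over a PID);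
  J. S. Milne, *Étale cohomology* (2025 reissue), V §1, p. 177 ("finitely generated as a
  `ℤ_l`-module", the form in which `ℓ`-adic cohomology groups are described). [Milne2025]
-/

universe v

open scoped DirectSum

namespace Literature.Algebra.Module.PadicInt

variable (p : ℕ) [Fact p.Prime]

/-- For a non-zero `x ∈ ℤ_p` the quotient ring `ℤ_p/(x)` is finite: `(x) = (p^n)` for some `n`
(`ℤ_p` is a discrete valuation ring with uniformiser `p`) and `ℤ_p/(p^n) ≅ ℤ/p^n ℤ`. [folklore] -/
theorem finite_quotient_span_singleton {x : ℤ_[p]} (hx : x ≠ 0) :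
    Finite (ℤ_[p] ⧸ Ideal.span {x}) := by
  obtain ⟨n, hn⟩ := PadicInt.ideal_eq_span_pow_p (s := Ideal.span {x})
    (by simpa only [ne_eq, Ideal.span_singleton_eq_bot] using hx)
  rw [hn, ← PadicInt.ker_toZModPow]
  haveI : NeZero (p ^ n) := ⟨pow_ne_zero _ (Fact.out : p.Prime).ne_zero⟩
  exact Finite.of_equiv _ (RingHom.quotientKerEquivOfSurjective
    (ZMod.ringHom_surjective (PadicInt.toZModPow n))).symm.toEquiv

/-- A cyclic torsion module `ℤ_p / ℤ_p ∙ q^e` with `q` irreducible is finite. [folklore] -/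
theorem finite_quotient_span_pow {q : ℤ_[p]} (hq : Irreducible q) (e : ℕ) :
    Finite (ℤ_[p] ⧸ Submodule.span ℤ_[p] {q ^ e}) :=
  finite_quotient_span_singleton p (pow_ne_zero e hq.ne_zero)

/-- **Structure theorem over `ℤ_p`, module form.** A finitely generated `ℤ_p`-module is
`ℤ_p`-linearly isomorphic to `ℤ_p^b × T` with `T` a finite `ℤ_p`-module (Bourbaki, *Algèbre*
VII §4 no. 4, over the PID `ℤ_p`; from Mathlib `Module.equiv_free_prod_directSum`). [folklore] -/
theorem exists_linearEquiv_prod_finite (M : Type v) [AddCommGroup M] [Module ℤ_[p] M]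
    [Module.Finite ℤ_[p] M] :
    ∃ (b : ℕ) (T : Type) (_ : AddCommGroup T) (_ : Module ℤ_[p] T) (_ : Finite T),
      Nonempty (M ≃ₗ[ℤ_[p]] (Fin b → ℤ_[p]) × T) := by
  obtain ⟨b, ι, _, q, hq, e, ⟨f⟩⟩ := Module.equiv_free_prod_directSum (R := ℤ_[p]) (M := M)
  classical
  haveI : ∀ i, Finite (ℤ_[p] ⧸ Submodule.span ℤ_[p] {q i ^ e i}) :=
    fun i => finite_quotient_span_pow p (hq i) (e i)
  refine ⟨b, ⨁ i : ι, ℤ_[p] ⧸ Submodule.span ℤ_[p] {q i ^ e i}, inferInstance, inferInstance,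
    Finite.of_equiv _ (DirectSum.linearEquivFunOnFintype ℤ_[p] ι _).symm.toEquiv, ⟨?_⟩⟩
  exact f.trans ((Finsupp.linearEquivFunOnFinite ℤ_[p] ℤ_[p] (Fin b)).prodCongr
    (LinearEquiv.refl _ _))

/-- **Structure theorem over `ℤ_p`, group form.** The additive group of a finitely generated
`ℤ_p`-module is isomorphic to `ℤ_p^b × T` with `T` a finite abelian group. This is the shape in
which "`H` is a finitely generated `ℤ_ℓ`-module" (Milne, *Étale cohomology*, V Lemma 1.11, p. 177
of the 2025 reissue) is recorded at group level. [folklore] -/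
theorem exists_addEquiv_prod_finite (M : Type v) [AddCommGroup M] [Module ℤ_[p] M]
    [Module.Finite ℤ_[p] M] :
    ∃ (b : ℕ) (T : Type) (_ : AddCommGroup T) (_ : Finite T),
      Nonempty (M ≃+ (Fin b → ℤ_[p]) × T) := by
  obtain ⟨b, T, _, _, _, ⟨f⟩⟩ := exists_linearEquiv_prod_finite p M
  exact ⟨b, T, inferInstance, inferInstance, ⟨f.toAddEquiv⟩⟩

/-- Variant with an *existentially given* module structure (the form of the named facts on
`ℓ`-adic cohomology groups, whose carrier has no canonical `ℤ_ℓ`-action in Mathlib yet): if an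
additive group admits some `ℤ_p`-module structure for which it is finitely generated, it is
isomorphic to `ℤ_p^b × T` with `T` finite. [folklore] -/
theorem exists_addEquiv_prod_finite_of_exists (M : Type v) [AddCommGroup M]
    (h : ∃ _ : Module ℤ_[p] M, Module.Finite ℤ_[p] M) :
    ∃ (b : ℕ) (T : Type) (_ : AddCommGroup T) (_ : Finite T),
      Nonempty (M ≃+ (Fin b → ℤ_[p]) × T) := by
  obtain ⟨_, _⟩ := h
  exact exists_addEquiv_prod_finite p M

end Literature.Algebra.Module.PadicInt
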